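import Summits.BirchSwinnertonDyer.BirchSwinnertonDyer.Theorems.EisensteinPrimesGoodLatticeBDPValueOfOneInequality
import Summits.BirchSwinnertonDyer.BirchSwinnertonDyer.Theorems.EisensteinPrimesThm141TorsionClauses
import HarnessLib

/-!
# Route `EisensteinPrimes`, crux 2 `GoodLatticeBDPValue`, line `halves` v17 → v18: the crux BY NAME with
# [ALG-imp] = KY Thm. 1.4.1 CUT DOWN TO ITS BARE `λ`-IDENTITY (its cotorsion / `μ = 0` clauses are KERNEL now)

Cell `bsd-eis` (home `run/shared/lean/pub/bsd-eis/`), seat `bsd-line-x1-p1` LEAD g3 (D-0154 KEY row 4),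
crux 2 `GoodLatticeBDPValue` (stmt-BirchSwinnertonDyer-19032). The composition of record
(`GoodLatticeBDPValueOfOneInequality.goodLatticeBDPValue_of_pub_of_imprimitive_of_le`, p616538, skeleton
`halves` v16/v17) consumes [ALG-imp] = `KellerYin2024.thm141_imprimlambda_goodLattice_OPEN` (KY Thm. 1.4.1,
PREPRINT) with THREE conjuncts: (i) `𝔛_f^{Sf}` f.g. `Λ`-torsion with `μ = 0`, (ii) the same for `𝔛_f`, (iii)
`λ(𝔛^{Sf}_f) + [𝟙̃|_{G_K} = 𝟙] = λ(𝔛^{Sf}_ω̃) + λ(𝔛^{Sf}_𝟙̃)`. (i)–(ii) are now the KERNEL theorem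
`Thm141TorsionClauses.moduleFinite_isTorsion_muInvariant_eq_zero_of_forall_dualData` (residual dévissage along
`0 → 𝔽(ω̃) → E_K[p] → 𝔽(𝟙̃) → 0` WITHOUT the non-anomalous clause, p628626, fed by the FIRST CLAUSE of [PWL-θ]
`prop125_residualPair_unrSelmer_imprimitive` — kernel modulo PUB, p631421 ∘ p611963 ∘ p569470 — through
Pontryagin + Kummer, p634599, and `…ResidualPairStableLine`). So the ONLY preprint input left on the
algebraic side is (iii), one numerical identity = the located GAP line (⋆) A7 itself, carried as the
hypothesis `h141lam` (binders of `thm141_…_OPEN` VERBATIM, conclusion (iii)). §1 `thm151ConclusionLE_of_lambda_at`,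
§2 `goodLatticeMuLambdaOnTree_of_div_of_le_of_lambda`, §3 **`goodLatticeBDPValue_of_pub_of_lambda_of_le`** =
the three theorems of `…OfOneInequality` with `h141` replaced by `h141lam` + the kernel clauses; §3 is the
composition of skeleton `halves` v18 (`stub_imprim` ↦ `stub_imprimLambda`).

HONEST FRAMING: CONDITIONAL on the named inputs (audit `proof.conditional`); closes nothing by itself; no
label or count moves; BSD / Mazur's MC / IMC2 is proved for no curve. References: KY arXiv:2402.12781v2
Thm. 1.4.1 (TeX L1087–1098), proofs of Thm. 3.0.8 (L1631–1640), Thm. 1.5.1 (L1358–1360), Thm. 2.2.3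
(L1455–1467); CGLS 2022 Thm. 4.1.2, Prop. 4.2.1, §1.4 Props. 17–18; Washington §7.1, §13.2.
-/

set_option linter.dupNamespace false
set_option autoImplicit false

noncomputable section

open scoped Classical

open PowerSeries WeierstrassCurve NumberField IsDedekindDomain Field Rat.HeightOneSpectrum
  Literature.NumberTheory.EllipticCurves Literature.NumberTheory.EllipticCurves.ModularForms
  Literature.NumberTheory.QuadraticFields Literature.NumberTheory.EllipticCurves.Rank1Residual
  Literature.NumberTheory.EllipticCurves.Castella2018 Literature.NumberTheory.EllipticCurves.KellerYin2024
  Literature.NumberTheory.EllipticCurves.CastellaGrossiLeeSkinner2022 Literature.NumberTheory.GaloisRepresentations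
  Literature.NumberTheory.EllipticCurves.GreenbergVatsal2000 Literature.NumberTheory.EllipticCurves.GreenbergSelmer
  Literature.NumberTheory.EllipticCurves.IwasawaAlgebra Literature.NumberTheory.EllipticCurves.BCGKPST2020
  Literature.NumberTheory.EllipticCurves.Rubin1991 Literature.NumberTheory.EllipticCurves.DeShalit1987
  Literature.NumberTheory.EllipticCurves.Hida2010MuInvariant Literature.NumberTheory.IwasawaTheory
  Literature.NumberTheory.IwasawaTheory.Greenberg2016 Literature.NumberTheory.IwasawaTheory.Greenberg2006
open Summit.BirchSwinnertonDyer.Rank1Residual.X11b.Halves Summit.BirchSwinnertonDyer.Rank1Residual.X1.KellerYinHalves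
  Summit.BirchSwinnertonDyer.Rank1Residual.X1.KellerYinMuLambdaSplit Summit.BirchSwinnertonDyer.BirchSwinnertonDyer.Theorems
  Summit.BirchSwinnertonDyer.Rank1Residual.X1.KellerYinMuLambdaSplitDS
  Summit.BirchSwinnertonDyer.Rank1Residual.X1.KellerYinMuLambdaSplitDSFree
  Summit.BirchSwinnertonDyer.BirchSwinnertonDyer.Theorems.IwasawaTwoVariable
  Summit.BirchSwinnertonDyer.BirchSwinnertonDyer.Theorems.EisensteinPrimesMuLambda
  Summit.BirchSwinnertonDyer.BirchSwinnertonDyer.Theorems.GoodLatticeBDPValueHalves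
  Summit.BirchSwinnertonDyer.BirchSwinnertonDyer.Theorems.GoodLatticeBDPValueOfImprimitive

namespace Summit.BirchSwinnertonDyer.BirchSwinnertonDyer.Theorems.GoodLatticeBDPValueOfLambdaIdentity
open Summit.BirchSwinnertonDyer.BirchSwinnertonDyer.Theorems.GoodLatticeBDPValueOfOneInequality

/-! ## §1 The pointwise glue with [ALG-imp] cut down to the `λ`-identity -/
/-- **KY Thm. 1.5.1's conclusion AT GIVEN DATA, `≤` form, with [ALG-imp] CUT DOWN TO ITS `λ`-IDENTITY**:
[RH] at the data + the bare `λ`-identity of KY Thm. 1.4.1 (`h141lam`: binders of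
`thm141_imprimlambda_goodLattice_OPEN` VERBATIM, conclusion its LAST conjunct only) + [PWL-θ]
(imprimitive form) + the INEQUALITY `corank_{ℤ_p}(Sel_v̄^{Sf}/Sel_v̄^∅) ≤ Σ_{w∈Sf} λ(𝒫_w(f))` AT THE DATA
⟹ `𝔛_f` is finitely generated `Λ`-torsion with `μ = 0` and
`λ(𝔛_ω̃) + λ(𝔛_𝟙̃) + Σ_w (λ𝒫_w(ω̃) + λ𝒫_w(𝟙̃)) ≤ λ(𝔛_f) + e + Σ_w λ𝒫_w(f)`. The proof of
`GoodLatticeBDPValueOfOneInequality.thm151ConclusionLE_of_thm141_at` line by line, except that the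
cotorsion / `μ = 0` / finite-generation clauses of Thm. 1.4.1 for `𝔛_f^{Sf}` and `𝔛_f` are now the
KERNEL theorem `Thm141TorsionClauses.moduleFinite_isTorsion_muInvariant_eq_zero_of_forall_dualData` fed by
[PWL-θ]'s first clause. CONDITIONAL; nothing booked. [claim: KellerYin2024, status: under-review]
[cite: KellerYin2024, proof of Thm. 1.5.1 (arXiv:2402.12781v2 TeX L1358–1360), Thm. 1.4.1 (L1087–1098)]
[cite: CastellaGrossiLeeSkinner2022, proof of Thm. 1.5.1 (MAINalgside; arXiv:2008.02571v2 TeX L909–931)] -/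
theorem thm151ConclusionLE_of_lambda_at
    (h141lam : ∀ (W : WeierstrassCurve ℚ) [W.IsElliptic] [W.IsGloballyMinimal] (p : ℕ) [Fact p.Prime],
      2 < p → Good W p → Red W p → Anom W p →
      (∀ Φ : AddSubgroup (geomTorsion W (p : ℤ)), IsRationalLine W p Φ → ¬ LineUnramifiedAt W p Φ) →
      ∀ (K : Type) [Field K] [NumberField K], IsImaginaryQuadratic K →
        SatisfiesHeegnerHypothesis (W.conductorNorm ℤ) K → SatisfiesHeegnerHypothesis p K →
        (∀ Q : (W.baseChange K).toAffine.Point, p • Q = 0 → Q = 0) →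
      ∀ (ι : K →+* ℚ_[p]) (v vbar : HeightOneSpectrum (𝓞 K)),
        (∀ x : 𝓞 K, x ∈ v.asIdeal ↔ ‖ι (x : K)‖ < 1) →
        ((p : ℕ) : 𝓞 K) ∈ vbar.asIdeal → vbar ≠ v →
      ∀ (κ : ZpExtension K p), κ.IsAnticyclotomic →
      ∀ (γ : absoluteGaloisGroup K) [Fact (κ.IsTopGenerator γ)],
      ∀ (θsub θquot : FramedGaloisRep K (padicCoeffIntegers (∅ : Set (PadicAlgCl p))) 1),
        IsResidualPairOver (W.baseChange K) p θsub θquot →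
      ∀ (Sf : Finset (HeightOneSpectrum (𝓞 K))),
        (∀ w : HeightOneSpectrum (𝓞 K), w ∈ Sf ↔ ((W.conductorNorm ℤ : ℤ) : 𝓞 K) ∈ w.asIdeal) →
      ∀ (DSsub : DatumDualData κ γ (charModule ∅ θsub)
          (AcSelmer.bdpData (charModule ∅ θsub) p vbar) (↑Sf : Set (HeightOneSpectrum (𝓞 K))))
        (DSquot : DatumDualData κ γ (charModule ∅ θquot)
          (AcSelmer.bdpData (charModule ∅ θquot) p vbar) (↑Sf : Set (HeightOneSpectrum (𝓞 K)))),
      lambdaInvariant p (AcSelmer.XAc (W.baseChange K) p κ vbar (↑Sf : Set (HeightOneSpectrum (𝓞 K))) γ) +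
          (if ∀ σ : absoluteGaloisGroup K, θquot σ = 1 then 1 else 0) =
        lambdaInvariant p DSsub.X + lambdaInvariant p DSquot.X)
    (h125 : prop125_residualPair_unrSelmer_imprimitive)
    (W : WeierstrassCurve ℚ) [W.IsElliptic] [W.IsGloballyMinimal] (p : ℕ) [Fact p.Prime]
    (hp : 2 < p) (hgood : Good W p) (hred : Red W p) (hanom : Anom W p)
    (hlat : ∀ Φ : AddSubgroup (geomTorsion W (p : ℤ)), IsRationalLine W p Φ → ¬ LineUnramifiedAt W p Φ)
    (K : Type) [Field K] [NumberField K] (hK : IsImaginaryQuadratic K)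
    (hH : SatisfiesHeegnerHypothesis (W.conductorNorm ℤ) K) (hHp : SatisfiesHeegnerHypothesis p K)
    (htor : ∀ Q : (W.baseChange K).toAffine.Point, p • Q = 0 → Q = 0)
    (ι : K →+* ℚ_[p]) (v vbar : HeightOneSpectrum (𝓞 K))
    (hv : ∀ x : 𝓞 K, x ∈ v.asIdeal ↔ ‖ι (x : K)‖ < 1)
    (hvbar : ((p : ℕ) : 𝓞 K) ∈ vbar.asIdeal) (hne : vbar ≠ v)
    (κ : ZpExtension K p) (hκ : κ.IsAnticyclotomic)
    (γ : absoluteGaloisGroup K) [Fact (κ.IsTopGenerator γ)]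
    (θsub θquot : FramedGaloisRep K (padicCoeffIntegers (∅ : Set (PadicAlgCl p))) 1)
    (hpair : IsResidualPairOver (W.baseChange K) p θsub θquot)
    (Sf : Finset (HeightOneSpectrum (𝓞 K)))
    (hSf : ∀ w : HeightOneSpectrum (𝓞 K), w ∈ Sf ↔ ((W.conductorNorm ℤ : ℤ) : 𝓞 K) ∈ w.asIdeal)
    (hRHsub : ∀ D : DatumDualData κ γ (charModule ∅ θsub)
        (AcSelmer.bdpData (charModule ∅ θsub) p vbar) (∅ : Set (HeightOneSpectrum (𝓞 K))),
      Module.Finite (IwasawaAlgebra p) D.X ∧ Module.IsTorsion (IwasawaAlgebra p) D.X ∧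
        muInvariant p D.X = 0)
    (hRHquot : ∀ D : DatumDualData κ γ (charModule ∅ θquot)
        (AcSelmer.bdpData (charModule ∅ θquot) p vbar) (∅ : Set (HeightOneSpectrum (𝓞 K))),
      Module.Finite (IwasawaAlgebra p) D.X ∧ Module.IsTorsion (IwasawaAlgebra p) D.X ∧
        muInvariant p D.X = 0)
    (Dsub : DatumDualData κ γ (charModule ∅ θsub)
        (AcSelmer.bdpData (charModule ∅ θsub) p vbar) ∅)
    (Dquot : DatumDualData κ γ (charModule ∅ θquot)
        (AcSelmer.bdpData (charModule ∅ θquot) p vbar) ∅)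
    (hcf : zpCorank (↥(AcSelmer.selmerAc (W.baseChange K) p κ vbar (↑Sf : Set (HeightOneSpectrum (𝓞 K)))) ⧸
        (AcSelmer.selmerAc (W.baseChange K) p κ vbar (∅ : Set (HeightOneSpectrum (𝓞 K)))).addSubgroupOf
          (AcSelmer.selmerAc (W.baseChange K) p κ vbar (↑Sf : Set (HeightOneSpectrum (𝓞 K))))) p ≤
      ∑ w ∈ Sf, curveLocalLambda κ (W.baseChange K) w) :
    Module.Finite (IwasawaAlgebra p) (AcSelmer.XAc (W.baseChange K) p κ vbar ∅ γ) ∧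
      Module.IsTorsion (IwasawaAlgebra p) (AcSelmer.XAc (W.baseChange K) p κ vbar ∅ γ) ∧
      muInvariant p (AcSelmer.XAc (W.baseChange K) p κ vbar ∅ γ) = 0 ∧
      lambdaInvariant p Dsub.X + lambdaInvariant p Dquot.X +
          ∑ w ∈ Sf, (charLocalLambda ∅ κ θsub w + charLocalLambda ∅ κ θquot w) ≤
        lambdaInvariant p (AcSelmer.XAc (W.baseChange K) p κ vbar ∅ γ) +
          (if ∀ σ : absoluteGaloisGroup K, θquot σ = 1 then 1 else 0) +
          ∑ w ∈ Sf, curveLocalLambda κ (W.baseChange K) w := by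
  have hγ : κ.IsTopGenerator γ := Fact.out
  obtain ⟨DSsub⟩ := nonempty_unrDualData_char (∅ : Set (PadicAlgCl p)) θsub κ vbar
    (↑Sf : Set (HeightOneSpectrum (𝓞 K))) hγ
  obtain ⟨DSquot⟩ := nonempty_unrDualData_char (∅ : Set (PadicAlgCl p)) θquot κ vbar
    (↑Sf : Set (HeightOneSpectrum (𝓞 K))) hγ
  have hlam := h141lam W p hp hgood hred hanom hlat K hK hH hHp htor ι v vbar hv hvbar hne κ hκ γ θsub
    θquot hpair Sf hSf DSsub DSquot
  obtain ⟨hSsub, hcsub⟩ := h125 W p hp hgood hred hanom hlat K hK hH hHp htor ι v vbar hv hvbar hne κ hκ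
    γ θsub θquot hpair Sf hSf θsub (Or.inl rfl) hRHsub
  obtain ⟨hSquot, hcquot⟩ := h125 W p hp hgood hred hanom hlat K hK hH hHp htor ι v vbar hv hvbar hne κ
    hκ γ θsub θquot hpair Sf hSf θquot (Or.inr rfl) hRHquot
  -- KY Thm. 1.4.1's cotorsion clauses IN THE KERNEL (residual dévissage, p628626 + this seat's files)
  obtain ⟨⟨hfgS, htorS, hμS⟩, ⟨hfg0, htor0, hμ0⟩⟩ :=
    Thm141TorsionClauses.moduleFinite_isTorsion_muInvariant_eq_zero_of_forall_dualData W hp K hK vbar hvbar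
      κ hκ γ hpair Sf hSf hSsub hSquot
  haveI := hfgS
  obtain ⟨-, -, -, -, hshiftf⟩ :=
    XAcImprimitiveLambdaShift.lambdaInvariant_eq_add_zpCorank_of_muInvariant_eq_zero (W.baseChange K) p
      κ vbar γ (Set.empty_subset (↑Sf : Set (HeightOneSpectrum (𝓞 K)))) htorS hμS
  obtain ⟨hfgSsub, htorSsub, hμSsub⟩ := hSsub DSsub
  obtain ⟨hfgSquot, htorSquot, hμSquot⟩ := hSquot DSquot
  haveI := hfgSsub
  haveI := hfgSquot
  obtain ⟨-, -, -, -, hshiftsub⟩ :=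
    UnrSelmerImprimitiveLambdaShift.lambdaInvariant_eq_add_zpCorank_of_muInvariant_eq_zero κ vbar
      (exists_pow_smul_cofree_eq_zero (∅ : Set (PadicAlgCl p)) θsub)
      (isOpen_stabilizer_cofree (∅ : Set (PadicAlgCl p)) θsub) hγ
      (Set.empty_subset (↑Sf : Set (HeightOneSpectrum (𝓞 K)))) DSsub htorSsub hμSsub Dsub
  obtain ⟨-, -, -, -, hshiftquot⟩ :=
    UnrSelmerImprimitiveLambdaShift.lambdaInvariant_eq_add_zpCorank_of_muInvariant_eq_zero κ vbar
      (exists_pow_smul_cofree_eq_zero (∅ : Set (PadicAlgCl p)) θquot)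
      (isOpen_stabilizer_cofree (∅ : Set (PadicAlgCl p)) θquot) hγ
      (Set.empty_subset (↑Sf : Set (HeightOneSpectrum (𝓞 K)))) DSquot htorSquot hμSquot Dquot
  refine ⟨hfg0, htor0, hμ0, ?_⟩
  rw [Finset.sum_add_distrib]
  rw [hcsub] at hshiftsub
  rw [hcquot] at hshiftquot
  generalize (if ∀ σ : absoluteGaloisGroup K, θquot σ = 1 then 1 else 0) = e at hlam ⊢
  generalize zpCorank (↥(AcSelmer.selmerAc (W.baseChange K) p κ vbar
      (↑Sf : Set (HeightOneSpectrum (𝓞 K)))) ⧸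
    (AcSelmer.selmerAc (W.baseChange K) p κ vbar (∅ : Set (HeightOneSpectrum (𝓞 K)))).addSubgroupOf
      (AcSelmer.selmerAc (W.baseChange K) p κ vbar (↑Sf : Set (HeightOneSpectrum (𝓞 K))))) p = c
    at hcf hshiftf
  omega

/-! ## §2 `GoodLatticeMuLambdaOnTree` from L-div + the `λ`-identity + [PWL-θ] + the `≤` half of [PWL-f] + [AN] -/
/-- **L-μλ for the good lattice from ONE inequality on the `f`-side and the BARE `λ`-identity of KY
Thm. 1.4.1**: `GoodLatticeMuLambdaOnTree W p` from L-div (PUB∘) + `h141lam` (PRE) + [PWL-θ] (imprimitive form)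
+ the class-wide `≤` half of [PWL-f] (kernel, p618030) + [AN]-DS-Free (PRE) + the road's PUB inputs; the proof
of `…OneInequality.goodLatticeMuLambdaOnTree_of_div_of_le_of_facts` line by line, the two uses of Thm. 1.4.1's
cotorsion clauses replaced by the kernel theorem. CONDITIONAL; nothing booked. [claim: KellerYin2024, status: under-review]
[cite: KellerYin2024, proof of Thm. 3.0.8 (arXiv:2402.12781v2 TeX L1631–1640), Thm. 1.4.1, proof of Thm. 1.5.1, Thms. 2.2.1–2.2.3]
[cite: CastellaGrossiLeeSkinner2022, Thm. 4.1.2, Rem. 4.1.3, Prop. 4.2.1, Thm. 2.2.2 with (2.16), proof of Thm. 1.5.1]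
[cite: BleherEtAl2020, §3.3 Thm. 3.3.1] [cite: deShalit1987, II.6.4 Theorem (i)] [cite: Hida2010MuInvariant, Thm. I] [cite: Washington1997, §7.1, §13.2] -/
theorem goodLatticeMuLambdaOnTree_of_div_of_le_of_lambda
    (h141lam : ∀ (W : WeierstrassCurve ℚ) [W.IsElliptic] [W.IsGloballyMinimal] (p : ℕ) [Fact p.Prime],
      2 < p → Good W p → Red W p → Anom W p →
      (∀ Φ : AddSubgroup (geomTorsion W (p : ℤ)), IsRationalLine W p Φ → ¬ LineUnramifiedAt W p Φ) →
      ∀ (K : Type) [Field K] [NumberField K], IsImaginaryQuadratic K →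
        SatisfiesHeegnerHypothesis (W.conductorNorm ℤ) K → SatisfiesHeegnerHypothesis p K →
        (∀ Q : (W.baseChange K).toAffine.Point, p • Q = 0 → Q = 0) →
      ∀ (ι : K →+* ℚ_[p]) (v vbar : HeightOneSpectrum (𝓞 K)),
        (∀ x : 𝓞 K, x ∈ v.asIdeal ↔ ‖ι (x : K)‖ < 1) →
        ((p : ℕ) : 𝓞 K) ∈ vbar.asIdeal → vbar ≠ v →
      ∀ (κ : ZpExtension K p), κ.IsAnticyclotomic →
      ∀ (γ : absoluteGaloisGroup K) [Fact (κ.IsTopGenerator γ)],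
      ∀ (θsub θquot : FramedGaloisRep K (padicCoeffIntegers (∅ : Set (PadicAlgCl p))) 1),
        IsResidualPairOver (W.baseChange K) p θsub θquot →
      ∀ (Sf : Finset (HeightOneSpectrum (𝓞 K))),
        (∀ w : HeightOneSpectrum (𝓞 K), w ∈ Sf ↔ ((W.conductorNorm ℤ : ℤ) : 𝓞 K) ∈ w.asIdeal) →
      ∀ (DSsub : DatumDualData κ γ (charModule ∅ θsub)
          (AcSelmer.bdpData (charModule ∅ θsub) p vbar) (↑Sf : Set (HeightOneSpectrum (𝓞 K))))
        (DSquot : DatumDualData κ γ (charModule ∅ θquot)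
          (AcSelmer.bdpData (charModule ∅ θquot) p vbar) (↑Sf : Set (HeightOneSpectrum (𝓞 K)))),
      lambdaInvariant p (AcSelmer.XAc (W.baseChange K) p κ vbar (↑Sf : Set (HeightOneSpectrum (𝓞 K))) γ) +
          (if ∀ σ : absoluteGaloisGroup K, θquot σ = 1 then 1 else 0) =
        lambdaInvariant p DSsub.X + lambdaInvariant p DSquot.X)
    (h125 : prop125_residualPair_unrSelmer_imprimitive)
    (h142le : ∀ (W : WeierstrassCurve ℚ) [W.IsElliptic] [W.IsGloballyMinimal] (p : ℕ) [Fact p.Prime],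
      2 < p → Good W p → Red W p → Anom W p →
      (∀ Φ : AddSubgroup (geomTorsion W (p : ℤ)), IsRationalLine W p Φ → ¬ LineUnramifiedAt W p Φ) →
      ∀ (K : Type) [Field K] [NumberField K], IsImaginaryQuadratic K →
        SatisfiesHeegnerHypothesis (W.conductorNorm ℤ) K → SatisfiesHeegnerHypothesis p K →
        (∀ Q : (W.baseChange K).toAffine.Point, p • Q = 0 → Q = 0) →
      ∀ (ι : K →+* ℚ_[p]) (v vbar : HeightOneSpectrum (𝓞 K)),
        (∀ x : 𝓞 K, x ∈ v.asIdeal ↔ ‖ι (x : K)‖ < 1) →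
        ((p : ℕ) : 𝓞 K) ∈ vbar.asIdeal → vbar ≠ v →
      ∀ (κ : ZpExtension K p), κ.IsAnticyclotomic →
      ∀ (γ : absoluteGaloisGroup K) [Fact (κ.IsTopGenerator γ)],
      ∀ (Sf : Finset (HeightOneSpectrum (𝓞 K))),
        (∀ w : HeightOneSpectrum (𝓞 K), w ∈ Sf ↔ ((W.conductorNorm ℤ : ℤ) : 𝓞 K) ∈ w.asIdeal) →
      Module.Finite (IwasawaAlgebra p) (AcSelmer.XAc (W.baseChange K) p κ vbar ∅ γ) →
      Module.IsTorsion (IwasawaAlgebra p) (AcSelmer.XAc (W.baseChange K) p κ vbar ∅ γ) →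
      zpCorank (↥(AcSelmer.selmerAc (W.baseChange K) p κ vbar (↑Sf : Set (HeightOneSpectrum (𝓞 K)))) ⧸
          (AcSelmer.selmerAc (W.baseChange K) p κ vbar (∅ : Set (HeightOneSpectrum (𝓞 K)))).addSubgroupOf
            (AcSelmer.selmerAc (W.baseChange K) p κ vbar (↑Sf : Set (HeightOneSpectrum (𝓞 K))))) p ≤
        ∑ w ∈ Sf, curveLocalLambda κ (W.baseChange K) w)
    (han : ∀ (W : WeierstrassCurve ℚ) [W.IsElliptic] [W.IsGloballyMinimal] (p : ℕ) [Fact p.Prime],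
      GoodLatticeAnalyticSideDSOnTreeFree W p)
    (h331 : thm331_rubin_exists_katzMeasure₂_pseudoIso_span_eq)
    (hv5 : ∀ (p : ℕ) [Fact p.Prime] (K : Type) [Field K] [NumberField K], 2 < p →
      IsImaginaryQuadratic K →
      ∀ (v vbar : HeightOneSpectrum (𝓞 K)),
        ((p : ℕ) : 𝓞 K) ∈ v.asIdeal → ((p : ℕ) : 𝓞 K) ∈ vbar.asIdeal → vbar ≠ v →
      ∀ (κ₁ κ₂ : ZpExtension K p) (γ₁ γ₂ : absoluteGaloisGroup K),
        ZpExtension.IsTopGeneratorPair κ₁ κ₂ γ₁ γ₂ →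
      ∀ (θ : FramedGaloisRep K (padicCoeffIntegers (∅ : Set (PadicAlgCl p))) 1) (n : ℕ),
        0 < n → ¬ p ∣ n → (∀ σ : absoluteGaloisGroup K, θ σ ^ n = 1) →
      ∀ (D : DualData₂ κ₁ κ₂ (charModule (∅ : Set (PadicAlgCl p)) θ) vbar γ₁ γ₂)
        (P : Submodule (IwasawaAlgebra₂ p) D.X), Module.IsPseudoNull (IwasawaAlgebra₂ p) P → P = ⊥)
    (hFE : thmII64_katzMeasure₂_functionalEquation) (hO1 : thmI_mu_katzBranch_reflect_eq_zero)
    (W : WeierstrassCurve ℚ) [W.IsElliptic] [W.IsGloballyMinimal] (p : ℕ) [Fact p.Prime]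
    (hLdiv : GoodLatticeDivOnTree W p) :
    GoodLatticeMuLambdaOnTree W p := by
  intro hp hgood hred hanom hGL K _ _ hK hHN hHp hodd h3 hEK hSel ι v vbar hv hvbar hne κ hκ γ hγ N _ Dt
    H ιC P hP ι' hι' ΩK Ωp L hΩK hL F hF
  -- §0: L-div at the data
  obtain ⟨-, k, hk⟩ := hLdiv hp hgood hred hanom hGL K hK hHN hHp hodd h3 hEK hSel ι v vbar hv hvbar hne
    κ hκ γ N Dt H ιC P hP ι' hι' ΩK Ωp L hΩK hL
  obtain ⟨Φ, hΦ, θsub, θquot, hsub, hquot⟩ := exists_teichmullerPair W p hred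
  have hpair : IsResidualPairOver (W.baseChange K) p (θsub.restrictField K) (θquot.restrictField K) :=
    isResidualPairOver_restrictField W p K hΦ hsub hquot
  have hN0 : W.conductorNorm ℤ ≠ 0 := (W.conductorNorm_pos_holds).ne'
  obtain ⟨Sf, hSf⟩ := exists_finset_places_dvd (K := K) (N := W.conductorNorm ℤ) hN0
  have hT1K : ∀ σ : absoluteGaloisGroup K, θquot.restrictField K σ ^ (p - 1) = 1 := fun σ ↦ hquot.1 _
  obtain ⟨θK, -, hθK'⟩ := exists_heckeCharacter_of_pow_eq_one ∅ ι' (θquot.restrictField K) hT1K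
  have hθK : IsHeckeCharOf ι' (θquot.restrictField K) θK := hθK'
  obtain ⟨Dsub⟩ := nonempty_unrDualData_char (∅ : Set (PadicAlgCl p)) (θsub.restrictField K) κ vbar
    (∅ : Set (HeightOneSpectrum (𝓞 K))) hγ.out
  obtain ⟨Dquot⟩ := nonempty_unrDualData_char (∅ : Set (PadicAlgCl p)) (θquot.restrictField K) κ vbar
    (∅ : Set (HeightOneSpectrum (𝓞 K))) hγ.out
  obtain ⟨S, κ', γ', Ω, δ, Ωp₂, G, g, hS, hgen, hΩ, hδ, hG, hJ, hg0, ⟨-, -, -, hlam1⟩, -, -, -, hlamω⟩ :=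
    goodLattice_jointMuLambda_of_facts h331 hv5 hFE hO1 W p hp hgood hred hanom hGL K hK hHN hHp hodd h3
      hEK hv hvbar hne hκ hι' hΦ hsub hquot hθK Dsub Dquot
  have hRHsub : ∀ D : DatumDualData κ γ (charModule ∅ (θsub.restrictField K))
      (AcSelmer.bdpData (charModule ∅ (θsub.restrictField K)) p vbar) (∅ : Set (HeightOneSpectrum (𝓞 K))),
      Module.Finite (IwasawaAlgebra p) D.X ∧ Module.IsTorsion (IwasawaAlgebra p) D.X ∧
        muInvariant p D.X = 0 := fun D ↦ by
    obtain ⟨_, _, _, _, _, _, _, _, -, -, -, -, -, -, -, -, hfin, htors, hmu, -⟩ :=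
      goodLattice_jointMuLambda_of_facts h331 hv5 hFE hO1 W p hp hgood hred hanom hGL K hK hHN hHp hodd h3
        hEK hv hvbar hne hκ hι' hΦ hsub hquot hθK D Dquot
    exact ⟨hfin, htors, hmu⟩
  have hRHquot : ∀ D : DatumDualData κ γ (charModule ∅ (θquot.restrictField K))
      (AcSelmer.bdpData (charModule ∅ (θquot.restrictField K)) p vbar) (∅ : Set (HeightOneSpectrum (𝓞 K))),
      Module.Finite (IwasawaAlgebra p) D.X ∧ Module.IsTorsion (IwasawaAlgebra p) D.X ∧
        muInvariant p D.X = 0 := fun D ↦ by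
    obtain ⟨_, _, _, _, _, _, _, _, -, -, -, -, -, -, -, ⟨hfin, htors, hmu, -⟩, -⟩ :=
      goodLattice_jointMuLambda_of_facts h331 hv5 hFE hO1 W p hp hgood hred hanom hGL K hK hHN hHp hodd h3
        hEK hv hvbar hne hκ hι' hΦ hsub hquot hθK Dsub D
    exact ⟨hfin, htors, hmu⟩
  -- §5′: the `f`-side `≤` at the data (its two `𝔛_f` inputs from [ALG-imp] at any imprimitive dual data)
  obtain ⟨hSsub, -⟩ := h125 W p hp hgood hred hanom hGL K hK hHN hHp hEK ι v vbar hv hvbar hne κ hκ γ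
    (θsub.restrictField K) (θquot.restrictField K) hpair Sf hSf (θsub.restrictField K) (Or.inl rfl) hRHsub
  obtain ⟨hSquot, -⟩ := h125 W p hp hgood hred hanom hGL K hK hHN hHp hEK ι v vbar hv hvbar hne κ hκ γ
    (θsub.restrictField K) (θquot.restrictField K) hpair Sf hSf (θquot.restrictField K) (Or.inr rfl) hRHquot
  obtain ⟨-, ⟨hfg0, htor0, -⟩⟩ :=
    Thm141TorsionClauses.moduleFinite_isTorsion_muInvariant_eq_zero_of_forall_dualData W hp K hK vbar hvbar
      κ hκ γ hpair Sf hSf hSsub hSquot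
  have hcf := h142le W p hp hgood hred hanom hGL K hK hHN hHp hEK ι v vbar hv hvbar hne κ hκ γ Sf hSf
    hfg0 htor0
  -- §5: [ALG]-`≤` = [ALG-imp] + [PWL-θ] + [PWL-f]-`≤` + [RH] (pointwise glue)
  obtain ⟨hXfin, hXtors, hXmu, hXlam⟩ := thm151ConclusionLE_of_lambda_at h141lam h125 W p hp hgood hred
    hanom hGL K hK hHN hHp hEK ι v vbar hv hvbar hne κ hκ γ (θsub.restrictField K) (θquot.restrictField K)
    hpair Sf hSf hRHsub hRHquot Dsub Dquot hcf
  obtain ⟨m, hm, hman⟩ := han W p hp hgood hred hanom hGL K hK hHN hHp hodd h3 hEK ι v vbar hv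
    hvbar hne κ hκ γ N Dt ι' hι' ΩK Ωp L hΩK hL (θsub.restrictField K) (θquot.restrictField K) hpair Sf
    hSf θK hθK S hS κ' γ' hgen Ω δ Ωp₂ G g hΩ hδ hG hJ hg0
  -- §7: bookkeeping: `λ(𝓛) ≤ λ(𝔛)`
  have hmle : m ≤ lambdaInvariant p (AcSelmer.XAc (W.baseChange K) p κ vbar ∅ γ) :=
    le_lambda_of_alg_le_of_an_of_bridge hXlam hman hlamω hlam1
  -- §8: the Weierstrass dictionary on the generator `F`, and L-div: `λ(𝔛) ≤ λ(𝓛)`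
  haveI := hXfin
  have hFU := firstUnitCoeff_map_toUnr_of_charIdeal_eq_span
    (AcSelmer.XAc (W.baseChange K) p κ vbar ∅ γ) hXtors hXmu (F := F) hF
  have hL' : FirstUnitCoeffAt L m := (firstUnitCoeffAt_iff L m).mp hm
  have hchar : Castella2018.AcSelmer.XAc.charIdeal (W.baseChange K) p κ vbar ∅ γ = Ideal.span {F} := hF
  rw [hchar, Ideal.map_span, Set.image_singleton] at hk
  have hle : lambdaInvariant p (AcSelmer.XAc (W.baseChange K) p κ vbar ∅ γ) ≤ m :=
    le_of_C_pow_mul_mem hk ((firstUnitCoeffAt_iff _ _).mpr hFU) hL'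
  have hlamX : lambdaInvariant p (AcSelmer.XAc (W.baseChange K) p κ vbar ∅ γ) = m := le_antisymm hle hmle
  rw [hlamX] at hFU
  exact ⟨m, hFU, hm⟩

/-! ## §3 The crux BY NAME with the bare `λ`-identity in place of [ALG-imp] -/
/-- **THE CRUX BY NAME — `Theses.EisensteinPrimes.GoodLatticeBDPValue` — from FOURTEEN PUBLISHED named
facts + Carayol, the BARE `λ`-IDENTITY of KY Thm. 1.4.1 (`h141lam`, PRE), [PWL-θ] (imprimitive form),
[AN]-DS-Free (PRE) and the `≤` HALF of [PWL-f]** — Thm. 1.4.1's clauses «`𝔛^S_f` and `𝔛_f` are both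
`Λ`-torsion with `μ`-invariants `0`» are NO LONGER INPUTS (kernel: `Thm141TorsionClauses`). Composition =
`KellerYinHalves.thm308_of_cgls_of_muLambda` on §2 with Rubin 5.3 (v) h_K-free = `noPseudoNull_of_pub`.
CONDITIONAL (audit `proof.conditional` on exactly the named hypotheses); closes nothing by itself; BSD is
proved for no curve. [claim: KellerYin2024, status: under-review]
[cite: KellerYin2024, Thm. 3.0.8 (IMC2) and proof (arXiv:2402.12781v2 TeX L1631–1640), Thm. 1.4.1, proof of Thm. 1.5.1, Thms. 2.2.1–2.2.3]
[cite: CastellaGrossiLeeSkinner2022, proof of Thm. 4.2.2, Thm. 4.1.2, Prop. 4.2.1, Thm. 5.1.3, Thm. 2.2.2, proof of Thm. 1.5.1, Prop. 1.2.5]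
[cite: PollackWeston2011, App. A Prop. A.2] [cite: CastellaHsieh2018, Def. 3.7 and Prop. 3.8] [cite: Carayol1986]
[cite: BleherEtAl2020, §3.3 Thm. 3.3.1] [cite: deShalit1987, II.6.4 Theorem (i)] [cite: Hida2010MuInvariant, Thm. I]
[cite: Greenberg2016Selmer, Prop. 4.1.1, Prop. 4.2.2] [cite: Greenberg2006, §5 A, Props. 3.2, 4.1, 4.2] [cite: NguyenQuangDo1984, Thm. 2.2] -/
theorem goodLatticeBDPValue_of_pub_of_lambda_of_le
    (hCH : castellaHsieh2018_exists_isBDPLFunction)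
    (hC : ∀ (N : ℕ) [NeZero N], IsNewformOf.level_eq_conductorNorm (N := N))
    (hdiv : proofThm422_exists_isBDPLFunction_isTorsion_charIdeal_dvd)
    (hval : thm513_exists_isBDPLFunction_valueAtOne)
    (h331 : thm331_rubin_exists_katzMeasure₂_pseudoIso_span_eq)
    (hFE : thmII64_katzMeasure₂_functionalEquation) (hO1 : thmI_mu_katzBranch_reflect_eq_zero)
    (h411 : prop411_selmer_isAlmostDivisible)
    (h422 : prop422_localCohomology_isAlmostDivisible) (h5A : sec5A_localH2_subsingleton_of_LOC1)
    (h41 : prop41_globalEulerPoincareCorank) (h42 : prop42_localEulerPoincareCorank)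
    (h32 : prop32_cohomology_isCofinitelyGenerated)
    (h33 : BCGKPST2020.sec33_rubin_unrSelmer₂_finite_torsion)
    (hT4 : weakLeopoldt_H2_subsingleton_above_cyclotomic_of_isOpen)
    (h141lam : ∀ (W : WeierstrassCurve ℚ) [W.IsElliptic] [W.IsGloballyMinimal] (p : ℕ) [Fact p.Prime],
      2 < p → Good W p → Red W p → Anom W p →
      (∀ Φ : AddSubgroup (geomTorsion W (p : ℤ)), IsRationalLine W p Φ → ¬ LineUnramifiedAt W p Φ) →
      ∀ (K : Type) [Field K] [NumberField K], IsImaginaryQuadratic K →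
        SatisfiesHeegnerHypothesis (W.conductorNorm ℤ) K → SatisfiesHeegnerHypothesis p K →
        (∀ Q : (W.baseChange K).toAffine.Point, p • Q = 0 → Q = 0) →
      ∀ (ι : K →+* ℚ_[p]) (v vbar : HeightOneSpectrum (𝓞 K)),
        (∀ x : 𝓞 K, x ∈ v.asIdeal ↔ ‖ι (x : K)‖ < 1) →
        ((p : ℕ) : 𝓞 K) ∈ vbar.asIdeal → vbar ≠ v →
      ∀ (κ : ZpExtension K p), κ.IsAnticyclotomic →
      ∀ (γ : absoluteGaloisGroup K) [Fact (κ.IsTopGenerator γ)],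
      ∀ (θsub θquot : FramedGaloisRep K (padicCoeffIntegers (∅ : Set (PadicAlgCl p))) 1),
        IsResidualPairOver (W.baseChange K) p θsub θquot →
      ∀ (Sf : Finset (HeightOneSpectrum (𝓞 K))),
        (∀ w : HeightOneSpectrum (𝓞 K), w ∈ Sf ↔ ((W.conductorNorm ℤ : ℤ) : 𝓞 K) ∈ w.asIdeal) →
      ∀ (DSsub : DatumDualData κ γ (charModule ∅ θsub)
          (AcSelmer.bdpData (charModule ∅ θsub) p vbar) (↑Sf : Set (HeightOneSpectrum (𝓞 K))))
        (DSquot : DatumDualData κ γ (charModule ∅ θquot)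
          (AcSelmer.bdpData (charModule ∅ θquot) p vbar) (↑Sf : Set (HeightOneSpectrum (𝓞 K)))),
      lambdaInvariant p (AcSelmer.XAc (W.baseChange K) p κ vbar (↑Sf : Set (HeightOneSpectrum (𝓞 K))) γ) +
          (if ∀ σ : absoluteGaloisGroup K, θquot σ = 1 then 1 else 0) =
        lambdaInvariant p DSsub.X + lambdaInvariant p DSquot.X)
    (h125 : prop125_residualPair_unrSelmer_imprimitive)
    (h142le : ∀ (W : WeierstrassCurve ℚ) [W.IsElliptic] [W.IsGloballyMinimal] (p : ℕ) [Fact p.Prime],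
      2 < p → Good W p → Red W p → Anom W p →
      (∀ Φ : AddSubgroup (geomTorsion W (p : ℤ)), IsRationalLine W p Φ → ¬ LineUnramifiedAt W p Φ) →
      ∀ (K : Type) [Field K] [NumberField K], IsImaginaryQuadratic K →
        SatisfiesHeegnerHypothesis (W.conductorNorm ℤ) K → SatisfiesHeegnerHypothesis p K →
        (∀ Q : (W.baseChange K).toAffine.Point, p • Q = 0 → Q = 0) →
      ∀ (ι : K →+* ℚ_[p]) (v vbar : HeightOneSpectrum (𝓞 K)),
        (∀ x : 𝓞 K, x ∈ v.asIdeal ↔ ‖ι (x : K)‖ < 1) →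
        ((p : ℕ) : 𝓞 K) ∈ vbar.asIdeal → vbar ≠ v →
      ∀ (κ : ZpExtension K p), κ.IsAnticyclotomic →
      ∀ (γ : absoluteGaloisGroup K) [Fact (κ.IsTopGenerator γ)],
      ∀ (Sf : Finset (HeightOneSpectrum (𝓞 K))),
        (∀ w : HeightOneSpectrum (𝓞 K), w ∈ Sf ↔ ((W.conductorNorm ℤ : ℤ) : 𝓞 K) ∈ w.asIdeal) →
      Module.Finite (IwasawaAlgebra p) (AcSelmer.XAc (W.baseChange K) p κ vbar ∅ γ) →
      Module.IsTorsion (IwasawaAlgebra p) (AcSelmer.XAc (W.baseChange K) p κ vbar ∅ γ) →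
      zpCorank (↥(AcSelmer.selmerAc (W.baseChange K) p κ vbar (↑Sf : Set (HeightOneSpectrum (𝓞 K)))) ⧸
          (AcSelmer.selmerAc (W.baseChange K) p κ vbar (∅ : Set (HeightOneSpectrum (𝓞 K)))).addSubgroupOf
            (AcSelmer.selmerAc (W.baseChange K) p κ vbar (↑Sf : Set (HeightOneSpectrum (𝓞 K))))) p ≤
        ∑ w ∈ Sf, curveLocalLambda κ (W.baseChange K) w)
    (han : ∀ (W : WeierstrassCurve ℚ) [W.IsElliptic] [W.IsGloballyMinimal] (p : ℕ) [Fact p.Prime],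
      GoodLatticeAnalyticSideDSOnTreeFree W p) :
    Summit.BirchSwinnertonDyer.BirchSwinnertonDyer.Theses.EisensteinPrimes.GoodLatticeBDPValue := by
  unfold Summit.BirchSwinnertonDyer.BirchSwinnertonDyer.Theses.EisensteinPrimes.GoodLatticeBDPValue
  exact thm308_of_cgls_of_muLambda hCH hC hdiv hval
    (fun W _ _ p _ ↦ goodLatticeMuLambdaOnTree_of_div_of_le_of_lambda h141lam h125 h142le han
      h331 (noPseudoNull_of_pub h411 h422 h5A h41 h42 h32 h33 hT4) hFE hO1 W p
      (goodLatticeDivOnTree_of_cgls hdiv hC W p))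

end Summit.BirchSwinnertonDyer.BirchSwinnertonDyer.Theorems.GoodLatticeBDPValueOfLambdaIdentity

end
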